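import Literature.AnabelianGeometry.SemiGraphs.TemperedAnabelianCor69OfSectionCriterion

/-!
# [SemiAnbd] Thm. 6.8 (iii)(iv) + Cor. 6.9 over the origin hypotheses: the F-1682 closer with the Cor. 6.9 binder REDUCED

Mochizuki, *Semi-graphs of anabelioids*, Publ. RIMS **42** (2006) [SemiAnbd], §6, Thm. 6.8 (iii)(iv)
and Cor. 6.9, ms. p. 75. [cite: MochizukiSemiAnbd2006, Thm 6.8(iii)-(iv), Cor 6.9 p.75]

PROOF-ONLY sibling (no definition, no new named fact; abc-iut cell, layer L3, D-0079 L-F pack D, seat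
abc-iut-L3-t7 gen 8) of `TemperedAnabelianThm68OriginClosers.lean` (gen 7, p455306): the reduction closer
`TemperedMorphismOrigin.decompositionPreservationHolds_of_parts` for the printed statement
`DecompositionPreservationHolds` (FACT-LIST F-1682) carried Cor. 6.9 (`IsoPreservesAllDecompGenusZeroNF`)
as a VERBATIM binder `h69` (GAP-LEDGER G-L3t7g7-2).  Here that binder is REPLACED, via
`TemperedCurve.isoPreservesAllDecompGenusZeroNF_of_sectionCriterion` (p490630: the kernel check of
print's "Corollary 6.9 follows from Theorem 6.8, (iv), by [the argument of] [Mzk8], Corollary 3.2"),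
by ONE named leaf quantified over the certified data — the tempered [Mzk8] Lemma 3.1 criterion
(i) ⟺ (iv) that print proves on pp. 75–77 (uniform in the finite extension `K′`, family-free; see that
file's docstring) — while every other input is a leaf ALREADY present in the gen-7 closer: (hΔ), Thm. 6.5
(iii) as printed (`CuspidalAbsolutenessHolds`), Thm. 6.5 (i)(ii)(iv) as printed
(`TemperedDecompositionGroupsHolds`, of which (ii) `DecompCommensurablyTerminal` and (iv)
`NoncuspidalNotLeCuspidal` are used), T68-B1 `DecompCompact`, and the Thm. 6.8 (iv) binder `hIV`
(G-L3t7g7-1, reading question Q-iv, unchanged).  HONEST FRAMING: reduced ≠ proved; the leaves are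
assumption LABELS on OUR typed statements of the refereed [SemiAnbd]/[Mzk8]; nothing of [SemiAnbd] §6 is
asserted; no statement is strengthened; nothing here takes a side on [IUTchIII] Cor. 3.12.
-/

noncomputable section

namespace Literature.AnabelianGeometry.SemiGraphs

open scoped Pointwise
open Topology

variable {p : ℕ} [Fact p.Prime]

namespace TemperedMorphismOrigin

open Thm68Sub

/-- **[SemiAnbd] Thm. 6.8 (iii)(iv) and Cor. 6.9 as printed (`DecompositionPreservationHolds`, FACT-LIST
F-1682), REDUCED to named leaves — Cor. 6.9 no longer a verbatim binder**: as
`decompositionPreservationHolds_of_parts` (torsion clause (iii) ⟸ the leaves of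
`isoPreservesTorsionDecomp_of_parts`; "in particular" of (iv) ⟸ its first sentence `hIV` + T68iv-L05),
with the Cor. 6.9 conjunct now DERIVED (`TemperedCurve.isoPreservesAllDecompGenusZeroNF_of_sectionCriterion`)
from `hIV` (Thm. 6.8 (iv), first sentence), `h65` (Thm. 6.5 (iii)), `h65i` (Thm. 6.5 (ii)(iv)), `hB1`
(T68-B1), `hΔ`, and the ONE new leaf `hcrit` = the tempered [Mzk8] Lemma 3.1 criterion (i) ⟺ (iv) of
[SemiAnbd] pp. 75–77 at every certified curve with certified flags.  Nothing of [SemiAnbd]/[Mzk8]/[Belyi]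
is asserted. [cite: MochizukiSemiAnbd2006, Thm 6.8(iii)-(iv), Cor 6.9 pp.75-77]
[cite: MochizukiGalSect2005, Lem 3.1, Cor 3.2 pp.13-14] -/
theorem decompositionPreservationHolds_of_parts_of_sectionCriterion (Ω : TemperedMorphismOrigin p)
    (hD : ∀ X : TemperedCurve p, Ω.IsHyperbolicCurveOrigin X →
      ∃ D : DLocSchemeData X, Ω.IsDLocOrigin D.toDLocContext)
    (hcurve : ∀ (X : TemperedCurve p) (D : DLocSchemeData X) (Z : D.DLocK),
      Ω.IsHyperbolicCurveOrigin X → Ω.IsDLocOrigin D.toDLocContext →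
        Ω.IsHyperbolicCurveOrigin (D.curve Z))
    (hL01 : ∀ (X : TemperedCurve p) (D : DLocSchemeData X), Ω.IsHyperbolicCurveOrigin X →
      Ω.IsDLocOrigin D.toDLocContext → CoveringObjectOfOpenSubgroup X D)
    (hL04 : ∀ (X : TemperedCurve p) (D : DLocSchemeData X), Ω.IsHyperbolicCurveOrigin X →
      Ω.IsDLocOrigin D.toDLocContext → PiFunctorBijectiveOnHom X D)
    (hB4 : ∀ (X : TemperedCurve p) (D : DLocSchemeData X), Ω.IsHyperbolicCurveOrigin X →
      Ω.IsDLocOrigin D.toDLocContext → CuspImageOpenInDecomp X D)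
    (hB1 : ∀ X : TemperedCurve p, Ω.IsHyperbolicCurveOrigin X → DecompCompact X)
    (h65 : Ω.CuspidalAbsolutenessHolds) (h65i : Ω.TemperedDecompositionGroupsHolds)
    (hΔ : ∀ X Y : TemperedCurve p, Ω.IsHyperbolicCurveOrigin X → Ω.IsHyperbolicCurveOrigin Y →
      ∀ α : X.PiTemp ≃ₜ* Y.PiTemp, X.DeltaTemp.map α.toMulEquiv.toMonoidHom = Y.DeltaTemp)
    (hT04 : ∀ (X : TemperedCurve p) (D : DLocSchemeData X) (a : TemperedCurve.CurveArithmeticFlags X),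
      Ω.IsHyperbolicCurveOrigin X → Ω.IsDLocOrigin D.toDLocContext → Ω.IsFlagsOrigin a →
        TorsionIffMulNCuspImage X D a)
    (hcusp : ∀ (X : TemperedCurve p) (a : TemperedCurve.CurveArithmeticFlags X),
      Ω.IsHyperbolicCurveOrigin X → Ω.IsFlagsOrigin a → a.IsOncePuncturedElliptic →
        ∀ x : X.Pt, X.IsCusp x → a.IsTorsionPt x)
    (hL05 : ∀ (X : TemperedCurve p) (a : TemperedCurve.CurveArithmeticFlags X),
      Ω.IsHyperbolicCurveOrigin X → Ω.IsFlagsOrigin a → DefinedOverNFIffExistsAlgebraic X a)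
    (hIV : ∀ (X Y : TemperedCurve p) (aX : TemperedCurve.CurveArithmeticFlags X)
      (aY : TemperedCurve.CurveArithmeticFlags Y), Ω.IsHyperbolicCurveOrigin X →
      Ω.IsHyperbolicCurveOrigin Y → Ω.IsFlagsOrigin aX → Ω.IsFlagsOrigin aY →
        ∀ α : X.PiTemp ≃ₜ* Y.PiTemp, X.IsoPreservesAlgebraicDecomp Y aX aY α)
    (hcrit : ∀ (X : TemperedCurve p) (a : TemperedCurve.CurveArithmeticFlags X),
      Ω.IsHyperbolicCurveOrigin X → Ω.IsFlagsOrigin a → a.IsDefinedOverNumberField →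
        ∀ D : Subgroup X.PiTemp, IsCompact (D : Set X.PiTemp) → D ⊓ X.DeltaTemp = ⊥ →
          IsOpen ((D ⊔ X.DeltaTemp : Subgroup X.PiTemp) : Set X.PiTemp) →
          (∀ c : X.Pt, X.IsCusp c → ∀ γ : ConjAct X.PiTemp, ¬ D ≤ γ • X.decomp c) →
          ((∃ x : X.Pt, ∃ γ : ConjAct X.PiTemp, D = γ • X.decomp x ⊓ (D ⊔ X.DeltaTemp)) ↔
            ∀ H : Subgroup X.PiTemp, IsOpen (H : Set X.PiTemp) → D ≤ H →
              ∃ x' : X.Pt, a.IsAlgebraicPt x' ∧ ∃ γ : ConjAct X.PiTemp,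
                γ • X.decomp x' ⊓ (D ⊔ X.DeltaTemp) ≤ H ∧
                  D ⊔ X.DeltaTemp ≤ γ • X.decomp x' ⊔ X.DeltaTemp)) :
    Ω.DecompositionPreservationHolds := by
  refine Ω.decompositionPreservationHolds_of_parts hD hcurve hL01 hL04 hB4 hB1 h65 h65i hΔ hT04 hcusp
    hL05 hIV ?_
  intro X Y aX aY hX hY haX haY α
  exact TemperedCurve.isoPreservesAllDecompGenusZeroNF_of_sectionCriterion aX aY
    (hcrit X aX hX haX) (hcrit Y aY hY haY) α (hΔ X Y hX hY α) (h65 X Y hX hY) (h65 Y X hY hX)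
    (h65i X hX).2.2.2.2 (h65i Y hY).2.2.2.2 (h65i X hX).2.2.1 (h65i Y hY).2.2.1 (hB1 X hX) (hB1 Y hY)
    (hIV X Y aX aY hX hY haX haY α)

end TemperedMorphismOrigin

end Literature.AnabelianGeometry.SemiGraphs

end
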